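import Mathlib
import HarnessLib
import Summits.Parity.BatemanHorn.Theses.RoughValueTransport
import Literature.NumberTheory.Sieve.RoughNumbersBuchstab
import Literature.NumberTheory.Sieve.PairRoughCount
import Literature.NumberTheory.Sieve.AletheiaZomleferFukshanskyGarcia2020ApplicationsArithProgProofs

/-!
# Disproof of `RoughValueLaw` (stmt-Parity-11390, route RoughValueTransport) — standing adversary

Work file of the crux disprover (`cdisprove-stmt-Parity-11390`). Everything below is
machine-checked (no `sorry`); prose lives in docstrings only.

## Findings (cycle 1)

* **No kill.** `RoughValueLaw` is the rough-value (almost-prime) form of the generalized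
  Hardy–Littlewood / Bateman–Horn heuristic: on `u ∈ (2,3]` the shape `(u ω(u))^k =
  (1 + log(u-1))^k` is exactly the HL prediction for "prime or balanced semiprime in each
  coordinate" (re-derived by hand for `X`, `X²+1`, `(X, X+2)`); every cheap degeneration
  (constants, duplicates, `k = 0`, negative leading coefficients, fixed prime divisors) is either
  excluded by `IsBatemanHornSystem` or makes the conclusion TRUE (theorems below). Numerics of the
  earlier attacks (items 9468/11390 evidence: `f = X` control and twins to `1e9`, `n²+1` to `3e8`,
  `n³+2` to `3e7`) sit within `0.33 %` of `(C/D)(uω(u))^k` at `u ≥ 3` with the Buchstab bump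
  `e^γ ω(3) = 1.0052` per coordinate visible — the planner's kill criterion (a converged deviation
  `> 0.3 %` at `u = 3`) is not met.
* **Load-bearing analysis** (any proof must use exactly these):
  - `pairwise_not_associated` — NECESSARY: `roughValueLaw_false_without_nonAssociated`
    (witness `(X, X)`: the ratio is `Buchstab × log x → ∞`).
  - `irreducible` — NECESSARY: `roughValueLaw_false_without_irreducible`
    (witness `(X, X²)` at `u = 4`: the count is `Φ(x, √x)`, ratio `→ ∞`).
  - `hasNoFixedPrimeDivisor` — necessary ONLY against constants:
    `roughValueLaw_false_without_noFixedPrimeDivisor` (witness the constant `2`, ratio `= log x`),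
    but `conclusion_of_not_hasNoFixedPrimeDivisor`: a NON-CONSTANT system with a fixed prime
    divisor satisfies the conclusion with `A = 0`.
  - `leadingCoeff_pos` — NOT load-bearing: `conclusion_of_leadingCoeff_neg` (`A = 0`).
  - the conclusion never forces `A ≠ 0`: `conclusion_of_roughCount_eventually_le`.
  - ω-clause `ω = 1/u on [1,2]` — NECESSARY: `roughValueLaw_false_without_omegaInit` (`ω ≡ 0`).
  - ω-clause `(uω)' = ω(u-1)` — NECESSARY: `roughValueLaw_false_without_omegaDDE` (`ω = 1/u`:
    the `f = X` limits `1 + log 2` at `u = 3` and `1 + log(3/2)` at `u = 5/2` are not both `A`).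
  - ω-clause `ContinuousOn ω (Ici 1)` — NOT load-bearing, in fact REDUNDANT:
    `continuousOn_of_init_of_dde` derives it from the other two clauses (the two-sided derivative
    of `uω(u)` at `u = 3` forces right-continuity of `ω` at `2`), so
    `roughValueLawWithoutOmegaCont_iff : RoughValueLawWithoutOmegaCont ↔ RoughValueLaw` and the
    predicate is `isBuchstab_iff : IsBuchstab ω ↔ (init ∧ delay equation)`.
  - strictness `2 < u` in the derivative clause is forced: `not_hasDerivAt_two_of_init`
    (with `ω = 1/u` on `[1,2]` the left derivative of `uω(u)` at `2` is `0 ≠ ω(1) = 1`), so a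
    variant with `2 ≤ u` there would be VACUOUSLY true.
* **Instances / tightness**: `tendsto_ratio_X` (the `f = X` rung holds for every `u ≥ 2` with
  `A = 1 = C(X)/deg X`, from the tree's PROVED `exists_abs_card_roughIcc_sub_buchstab_le`),
  `tendsto_ratio_X_explicit` (`→ 1 + log(u-1)` on `(2,3]`), `tendsto_ratio_twoXAddOne` /
  `conclusion_twoXAddOne` (a SECOND proved rung, `f = 2X+1`, with the non-trivial constant
  `A = 2 = C(2X+1)/deg`: the normalisation `A = C(f)/∏ deg fᵢ` is right where it can be tested),
  `conclusion_fin_zero` / `isBatemanHornSystem_fin_zero` (`k = 0` holds with `A = 1`),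
  `conclusion_const_nonneg` (`A ≥ 0` always).
* **Refuted natural strengthening**: `not_roughValueLawUniform` — the limit is NOT uniform in
  `u ∈ (2, ∞)` (at `u ≍ log x` the count is all of `[1,x]`: the `x → ∞` and `u → ∞` limits do not
  commute beyond `u = o(log x)`; SieveCalibration rightly takes `u → ∞` AFTER `x → ∞`).
* **Strength calibration** (`eventually_cardFactors_le_two`): for EVERY family of non-constant
  polynomials and every depth `u < 3`, all jointly rough arguments counted by the crux have
  `Ω(fᵢ(n)) ≤ 2` in every coordinate once `x` is large; so a positive rung below `u = 3` (and
  SieveCalibration forces `A = C(f)/∏deg > 0`) gives `≫ x/(log x)^k` simultaneous `P₂`-values — open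
  for any single polynomial of degree `≥ 3` (Richert: `P_{d+1}`; `P₂` only in degree `≤ 2`,
  Iwaniec 1978), and for `k ≥ 2` beyond Chen-type results.
* **What `irreducible` really guards** (`conclusion_pairPoly`, theorem): the refuting witness
  `(X, X²)` is NON-SQUAREFREE (`X²` inflates `natDegree`, hence the sifting depth, without adding a
  sieve dimension); the squarefree reducible member `X(X+2)` instead makes the count two-dimensional
  while the normalisation stays `(log x)^1`, so its ratio tends to `0` (tree theorem
  `PairRough.card_pair_rough_le`) and `A = 0` satisfies the conclusion — the data a proof actually
  consumes are the distinct irreducible factors of `∏ fᵢ` and their degrees.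
* **Numerics (this seat)**: compute jobs `j005412` (smoke) and `j005677` (full) — Part A:
  drift-free ratios `Φ_f/(x·V_f·∏ e^γω(u))` for the NEW systems `X²+X+1`, `(X, X²+X+1)` (`k = 2`),
  `X⁴+1` (degree 4, `ν(p) = 4` on `p ≡ 1 (8)`) with controls `X`, `X²+1` at `x = 10⁸` (`2·10⁶` for
  the quartic); Part B (NEW REGIME, no sieve information exists there): the cubic `X³+2` at depths
  `u ∈ (2,3]`, `z = x^{3/u} > x`, by factoring the `≈ x/log x` survivors of the sieve up to `x`
  (python-flint) and reading the least-prime-factor profile against `(1+log(u-1))/(1+log 2)` and the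
  finite-`x` Hardy–Littlewood integral (constant-free ratios). Results: PENDING at this update
  (queue); earlier seats' numerics (`X`, twins to `10⁹`; `n²+1` to `3·10⁸`; `n³+2` to `3·10⁷`,
  `u ≥ 3`) agree with the crux to `0.33 %`.
* **Barrier catalogue** (`Literature/Barriers/Parity/`): the only catalogued `f`-SPECIFIC bias of a
  Bateman–Horn count is `FunctionFieldMobiusBias` (Conrad–Conrad–Gross 2008: over `κ[u]`, for
  INSEPARABLE `f ∈ κ[u][T^p]`, `μ(f(g))` is periodic in `g`, so the parity of `Ω(f(g))` is biased
  and the naive local heuristic fails by the factor `Λ_κ(f;n) ∈ [0,2]`). A kill of `RoughValueLaw`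
  at a rung `u ∈ (2,3)` would be exactly such a parity bias over `ℤ` (prime vs balanced-semiprime
  values inside the rough set); its scope caveat applies verbatim — every `f ∈ ℤ[T]` is separable
  and no discriminant/periodicity formula for `μ` on `ℤ` exists — so it does not bite; Part B of the
  numerics job measures this prime : semiprime split for a cubic at finite `x`. The parity-type
  barriers `SelbergParityBarrier`, `LinearSieveOptimality`, `FordMaynardLowLevel` APPLY to the crux
  as statements of unprovability by Type-I/II information at each fixed rung, not of falsity
  (acknowledged by the route).
* **Why it resists**: every rung `u ∈ (2,3)` contains `P_f(x)` as the fixed fraction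
  `(1+log(u-1))^{-k}` of `Φ_f(x,u)`, so a disproof at any rung is an `f`-specific bias of rough
  values of Bateman–Horn strength; the only unconditional rung in the tree is `f = (X)` (and
  `aX+b`), where the law is a THEOREM. Barriers (SelbergParity, LinearSieveOptimality,
  FordMaynardLowLevel) speak to unprovability by Type-I/II information, not to falsity.
-/

open Filter Finset Polynomial
open scoped Topology

namespace Summit.Parity.BatemanHorn.Cruxes.RoughValueLaw.Disproof

open Literature.NumberTheory.Sieve

/-- The inline Buchstab predicate of the crux. -/
def IsBuchstab (ω : ℝ → ℝ) : Prop :=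
  (∀ u : ℝ, 1 ≤ u → u ≤ 2 → ω u = u⁻¹) ∧ ContinuousOn ω (Set.Ici 1) ∧
    (∀ u : ℝ, 2 < u → HasDerivAt (fun t : ℝ => t * ω t) (ω (u - 1)) u)

/-- The jointly-rough-value count `Φ_f(x,u)` of the crux. -/
noncomputable def roughCount {k : ℕ} (f : Fin k → ℤ[X]) (u : ℝ) (x : ℕ) : ℕ :=
  ((Finset.Icc 1 x).filter (fun n : ℕ => ∀ i, 0 < (f i).eval (n : ℤ) ∧
    ∀ p ∈ Finset.range ⌈(x : ℝ) ^ (((f i).natDegree : ℝ) / u)⌉₊,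
      p.Prime → ¬ ((p : ℤ) ∣ (f i).eval (n : ℤ)))).card

/-- The normalised ratio `Φ_f(x,u) (log x)^k / x`. -/
noncomputable def ratio {k : ℕ} (f : Fin k → ℤ[X]) (u : ℝ) (x : ℕ) : ℝ :=
  (roughCount f u x : ℝ) * Real.log x ^ k / (x : ℝ)

/-- The conclusion of the crux for one system and one `ω`. -/
def Conclusion {k : ℕ} (f : Fin k → ℤ[X]) (ω : ℝ → ℝ) : Prop :=
  ∃ A : ℝ, ∀ u : ℝ, 2 < u → Tendsto (ratio f u) atTop (𝓝 (A * (u * ω u) ^ k))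

/-- The crux unfolds to `∀ systems, ∀ ω with the inline Buchstab predicate, Conclusion`. -/
theorem roughValueLaw_iff :
    Summit.Parity.BatemanHorn.Theses.RoughValueTransport.RoughValueLaw ↔
      ∀ (k : ℕ) (f : Fin k → ℤ[X]), IsBatemanHornSystem f → ∀ ω, IsBuchstab ω → Conclusion f ω :=
  Iff.rfl

/-- NON-VACUITY of the inline predicate: the tree's `buchstabOmega` satisfies it. -/
theorem isBuchstab_buchstabOmega : IsBuchstab buchstabOmega :=
  ⟨fun _ h1 h2 => buchstabOmega_eq_inv h1 h2, continuousOn_buchstabOmega,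
    fun _ hu => hasDerivAt_mul_buchstabOmega hu⟩

/-! ### The sifting condition in terms of `roughIcc` -/

/-- `(∀ p < N prime, ¬ p ∣ n) ↔ (every prime factor of `n` is `≥ N`)` for `n ≥ 1`. -/
theorem forall_range_prime_not_dvd_iff (N n : ℕ) :
    (∀ p ∈ Finset.range N, p.Prime → ¬ ((p : ℤ) ∣ (n : ℤ))) ↔
      ∀ p : ℕ, p.Prime → p ∣ n → N ≤ p := by
  simp only [Finset.mem_range, Int.natCast_dvd_natCast]
  constructor
  · intro h p hp hpn
    by_contra hlt
    exact h p (not_le.mp hlt) hp hpn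
  · intro h p hpN hp hpn
    exact absurd (h p hp hpn) (not_le.mpr hpN)

/-- The crux's finset for `f = ![X]` is `roughIcc ⌈x^{1/u}⌉₊ x`. -/
theorem roughCount_X (u : ℝ) (x : ℕ) :
    roughCount ![(X : ℤ[X])] u x = (roughIcc ⌈(x : ℝ) ^ (1 / u)⌉₊ x).card := by
  unfold roughCount
  congr 1
  ext n
  simp only [Finset.mem_filter, Fin.forall_fin_one, Matrix.cons_val_fin_one, eval_X,
    natDegree_X, Nat.cast_one, mem_roughIcc, Finset.mem_Icc]
  rw [forall_range_prime_not_dvd_iff]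
  constructor
  · rintro ⟨h1, -, h3⟩
    exact ⟨h1, h3⟩
  · rintro ⟨h1, h3⟩
    exact ⟨h1, by exact_mod_cast h1.1, h3⟩

/-- **Buchstab–de Bruijn for the ratio**: `#roughIcc ⌈x^{1/v}⌉₊ x · log x / x → v ω(v)` for
`v ≥ 2` (from the tree's PROVED `exists_abs_card_roughIcc_sub_buchstab_le`). -/
theorem tendsto_card_roughIcc_mul_log_div (v : ℝ) (hv : 2 ≤ v) :
    Tendsto (fun x : ℕ => ((roughIcc ⌈(x : ℝ) ^ (1 / v)⌉₊ x).card : ℝ) * Real.log x / x)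
      atTop (𝓝 (v * buchstabOmega v)) := by
  obtain ⟨C, hC0, hC⟩ := exists_abs_card_roughIcc_sub_buchstab_le v
  have hv0 : 0 < v := by linarith
  -- the error bound `C v² / log x → 0`
  have hlog : Tendsto (fun x : ℕ => Real.log (x : ℝ)) atTop atTop :=
    Real.tendsto_log_atTop.comp tendsto_natCast_atTop_atTop
  have herr : Tendsto (fun x : ℕ => C * v ^ 2 / Real.log (x : ℝ)) atTop (𝓝 0) := by
    have := hlog.inv_tendsto_atTop
    simpa [div_eq_mul_inv] using this.const_mul (C * v ^ 2)
  rw [← tendsto_sub_nhds_zero_iff]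
  refine squeeze_zero_norm' ?_ herr
  -- eventually `x ≥ 2^v`, so that `y = x^{1/v} ≥ 2`
  have hev : ∀ᶠ x : ℕ in atTop, (2 : ℝ) ^ v ≤ (x : ℝ) :=
    tendsto_natCast_atTop_atTop.eventually_ge_atTop _
  filter_upwards [hev] with x hx
  set y : ℝ := (x : ℝ) ^ (1 / v) with hy
  have hx1 : (1 : ℝ) < x := lt_of_lt_of_le (by
    have : (1:ℝ) < (2:ℝ) ^ v := Real.one_lt_rpow (by norm_num) hv0
    exact this) hx
  have hx0 : (0 : ℝ) < x := by linarith
  have hy2 : 2 ≤ y := by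
    have : ((2 : ℝ) ^ v) ^ (1 / v) ≤ (x : ℝ) ^ (1 / v) :=
      Real.rpow_le_rpow (by positivity) hx (by positivity)
    rwa [← Real.rpow_mul (by norm_num), mul_one_div_cancel hv0.ne', Real.rpow_one] at this
  have hyv : y ^ v = x := by
    rw [hy, ← Real.rpow_mul hx0.le, one_div_mul_cancel hv0.ne', Real.rpow_one]
  have hy2x : y ^ 2 ≤ (x : ℝ) := by
    have h1y : 1 ≤ y := by linarith
    calc y ^ 2 = y ^ (2 : ℝ) := by norm_cast
      _ ≤ y ^ v := Real.rpow_le_rpow_of_exponent_le h1y hv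
      _ = x := hyv
  have hxy : (x : ℝ) ≤ y ^ v := hyv.ge
  have hlogy : Real.log y = Real.log x / v := by
    rw [hy, Real.log_rpow hx0]; ring
  have hlogx : 0 < Real.log x := Real.log_pos hx1
  have hlogy0 : 0 < Real.log y := by rw [hlogy]; positivity
  have key := hC x y hy2 hy2x hxy
  rw [Nat.floor_natCast] at key
  have hu : Real.log x / Real.log y = v := by
    rw [hlogy]; field_simp
  rw [hu] at key
  -- key : |card - ω v * x / log y| ≤ C * x / log y ^ 2
  rw [Real.norm_eq_abs]
  have hcard := key
  rw [hlogy] at hcard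
  -- |card - ω v * x / (log x / v)| ≤ C x /(log x / v)^2
  have e1 : ((roughIcc ⌈y⌉₊ x).card : ℝ) * Real.log x / x - v * buchstabOmega v =
      (((roughIcc ⌈y⌉₊ x).card : ℝ) - buchstabOmega v * x / (Real.log x / v)) *
        (Real.log x / x) := by
    field_simp
  rw [e1, abs_mul, abs_of_pos (by positivity : 0 < Real.log x / x)]
  calc |((roughIcc ⌈y⌉₊ x).card : ℝ) - buchstabOmega v * x / (Real.log x / v)| * (Real.log x / x)
      ≤ C * x / (Real.log x / v) ^ 2 * (Real.log x / x) := by gcongr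
    _ = C * v ^ 2 / Real.log x := by field_simp

/-- The `f = ![X]` instance of the crux's conclusion holds with `A = 1` at `ω = buchstabOmega`,
for every `u ≥ 2` (Buchstab–de Bruijn; tree theorem `exists_abs_card_roughIcc_sub_buchstab_le`). -/
theorem tendsto_ratio_X (u : ℝ) (hu : 2 ≤ u) :
    Tendsto (ratio ![(X : ℤ[X])] u) atTop (𝓝 (u * buchstabOmega u)) := by
  have h := tendsto_card_roughIcc_mul_log_div u hu
  refine h.congr fun x => ?_
  simp only [ratio, roughCount_X, pow_one]

/-- The `f = (X)` rung of the crux: `Conclusion (X) buchstabOmega` with `A = 1`. -/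
theorem conclusion_X : Conclusion ![(X : ℤ[X])] buchstabOmega :=
  ⟨1, fun u hu => by simpa using tendsto_ratio_X u hu.le⟩


/-! ### A second proved rung with a non-trivial singular series: `f = 2X+1`, `A = C(f) = 2` -/

/-- The arithmetic progression `2X + 1` as a one-member family. -/
noncomputable abbrev twoXAddOne : Fin 1 → ℤ[X] := ![C 2 * X + C 1]

/-- `(2X+1)` is a Bateman–Horn system (tree: `isBatemanHornSystem_linear 2 1`). -/
theorem isBatemanHornSystem_twoXAddOne : IsBatemanHornSystem twoXAddOne := by
  have h := isBatemanHornSystem_linear 2 1 (by norm_num) (by norm_num)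
  simp only [Nat.cast_ofNat, Nat.cast_one] at h
  exact h

/-- `deg (2X+1) = 1`. -/
theorem natDegree_twoXAddOne : (C (2 : ℤ) * X + C 1 : ℤ[X]).natDegree = 1 := by
  compute_degree!

/-- The crux's finset for `2X+1`, pushed forward by `n ↦ 2n+1`, is the set of rough numbers in
`[1, 2x+1]` with `1` removed (once `2` is sifted, i.e. `⌈x^{1/u}⌉₊ > 2`). -/
theorem roughCount_twoXAddOne {u : ℝ} {x : ℕ} (hN : 2 < ⌈(x : ℝ) ^ (1 / u)⌉₊) :
    roughCount twoXAddOne u x + 1 = (roughIcc ⌈(x : ℝ) ^ (1 / u)⌉₊ (2 * x + 1)).card := by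
  set N : ℕ := ⌈(x : ℝ) ^ (1 / u)⌉₊ with hNdef
  unfold roughCount
  set F := (Finset.Icc 1 x).filter (fun n : ℕ => ∀ i, 0 < (twoXAddOne i).eval (n : ℤ) ∧
    ∀ p ∈ Finset.range ⌈(x : ℝ) ^ (((twoXAddOne i).natDegree : ℝ) / u)⌉₊,
      p.Prime → ¬ ((p : ℤ) ∣ (twoXAddOne i).eval (n : ℤ))) with hF
  -- membership in F
  have hmemF : ∀ n : ℕ, n ∈ F ↔ (1 ≤ n ∧ n ≤ x) ∧ ∀ p : ℕ, p.Prime → p ∣ 2 * n + 1 → N ≤ p := by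
    intro n
    rw [hF, Finset.mem_filter, Finset.mem_Icc, Fin.forall_fin_one]
    simp only [twoXAddOne, Matrix.cons_val_fin_one, natDegree_twoXAddOne, Nat.cast_one, eval_add,
      eval_mul, eval_C, eval_X]
    rw [show (2 : ℤ) * (n : ℤ) + 1 = ((2 * n + 1 : ℕ) : ℤ) by push_cast; ring,
      forall_range_prime_not_dvd_iff]
    constructor
    · rintro ⟨h1, -, h2⟩; exact ⟨h1, h2⟩
    · rintro ⟨h1, h2⟩; exact ⟨h1, by positivity, h2⟩
  have h1mem : 1 ∈ roughIcc N (2 * x + 1) := by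
    rw [mem_roughIcc]
    refine ⟨⟨le_rfl, by omega⟩, fun p hp hp1 => ?_⟩
    have h1 := Nat.le_of_dvd one_pos hp1
    have h2 := hp.one_lt
    omega
  have himage : F.map ⟨fun n : ℕ => 2 * n + 1, fun a b h => by simpa using h⟩ =
      (roughIcc N (2 * x + 1)).erase 1 := by
    ext m
    rw [Finset.mem_map, Finset.mem_erase, mem_roughIcc]
    constructor
    · rintro ⟨n, hn, rfl⟩
      rw [hmemF] at hn
      simp only [Function.Embedding.coeFn_mk]
      exact ⟨by omega, ⟨by omega, by omega⟩, hn.2⟩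
    · rintro ⟨hm1, ⟨hm1', hmx⟩, hrough⟩
      -- m is odd: 2 < N ≤ every prime factor
      have hodd : ¬ 2 ∣ m := fun h2 => absurd (hrough 2 Nat.prime_two h2) (by omega)
      obtain ⟨n, rfl⟩ : ∃ n, m = 2 * n + 1 := ⟨m / 2, by omega⟩
      refine ⟨n, ?_, rfl⟩
      rw [hmemF]
      exact ⟨⟨by omega, by omega⟩, hrough⟩
  have hcard := congrArg Finset.card himage
  rw [Finset.card_map, Finset.card_erase_of_mem h1mem] at hcard
  have hpos : 0 < (roughIcc N (2 * x + 1)).card := Finset.card_pos.mpr ⟨1, h1mem⟩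
  omega

/-- **The `2X+1` rung**: `Φ_{2X+1}(x,u)·log x/x → 2·uω(u)` for every `u ≥ 2`, i.e. the conclusion of
the crux holds for the progression `2X+1` with `A = 2 = C(2X+1)/deg` (the singular series of the odd
numbers) — a second machine-checked instance of the normalisation `A = C(f)/∏ deg fᵢ`, now with a
non-trivial constant (Buchstab–de Bruijn on `[1, 2x+1]`, tree theorem
`exists_abs_card_roughIcc_sub_buchstab_le`, and continuity of `ω`). -/
theorem tendsto_ratio_twoXAddOne (u : ℝ) (hu : 2 ≤ u) :
    Tendsto (ratio twoXAddOne u) atTop (𝓝 (2 * (u * buchstabOmega u))) := by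
  obtain ⟨C, hC0, hC⟩ := exists_abs_card_roughIcc_sub_buchstab_le (2 * u)
  have hu0 : 0 < u := by linarith
  -- notation
  let y : ℕ → ℝ := fun x => (x : ℝ) ^ (1 / u)
  let X' : ℕ → ℝ := fun x => ((2 * x + 1 : ℕ) : ℝ)
  let ux : ℕ → ℝ := fun x => Real.log (X' x) / Real.log (y x)
  -- Step 1: u_x → u
  have hlog : Tendsto (fun x : ℕ => Real.log (x : ℝ)) atTop atTop :=
    Real.tendsto_log_atTop.comp tendsto_natCast_atTop_atTop
  have hratio_log : Tendsto (fun x : ℕ => Real.log (X' x) / Real.log (x : ℝ)) atTop (𝓝 1) := by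
    -- log(2x+1) = log x + log(2 + 1/x)
    have hdiff : Tendsto (fun x : ℕ => Real.log (X' x) - Real.log (x : ℝ)) atTop
        (𝓝 (Real.log 2)) := by
      have h2 : Tendsto (fun x : ℕ => (2 : ℝ) + 1 / (x : ℝ)) atTop (𝓝 2) := by
        simpa using tendsto_const_nhds.add
          (tendsto_const_nhds.div_atTop tendsto_natCast_atTop_atTop :
            Tendsto (fun x : ℕ => (1 : ℝ) / (x : ℝ)) atTop (𝓝 0))
      have h3 := (Real.continuousAt_log (by norm_num : (2 : ℝ) ≠ 0)).tendsto.comp h2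
      refine h3.congr' ?_
      filter_upwards [eventually_gt_atTop 0] with x hx
      have hx0 : (0 : ℝ) < x := by exact_mod_cast hx
      simp only [Function.comp, X']
      rw [← Real.log_div (by positivity) hx0.ne']
      congr 1
      push_cast
      field_simp
    -- (log X' - log x)/log x → 0, so log X'/log x → 1
    have h4 : Tendsto (fun x : ℕ => (Real.log (X' x) - Real.log (x : ℝ)) / Real.log (x : ℝ))
        atTop (𝓝 0) := hdiff.div_atTop hlog
    have h5 := h4.add_const 1
    rw [zero_add] at h5
    refine h5.congr' ?_
    filter_upwards [hlog.eventually_gt_atTop 0] with x hx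
    field_simp
    ring
  have hux : Tendsto ux atTop (𝓝 u) := by
    have : Tendsto (fun x : ℕ => u * (Real.log (X' x) / Real.log (x : ℝ))) atTop (𝓝 (u * 1)) :=
      hratio_log.const_mul u
    rw [mul_one] at this
    refine this.congr' ?_
    filter_upwards [eventually_gt_atTop 0] with x hx
    have hx0 : (0 : ℝ) < x := by exact_mod_cast hx
    simp only [ux, y]
    rw [Real.log_rpow hx0]
    field_simp
  have hω : Tendsto (fun x : ℕ => buchstabOmega (ux x)) atTop (𝓝 (buchstabOmega u)) :=
    (continuousAt_buchstabOmega (by linarith)).tendsto.comp hux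
  -- Step 2: the main term ω(u_x) · (X'/x) · u → ω(u) · 2 · u
  have hX'x : Tendsto (fun x : ℕ => X' x / (x : ℝ)) atTop (𝓝 2) := by
    have h2 : Tendsto (fun x : ℕ => (2 : ℝ) + 1 / (x : ℝ)) atTop (𝓝 2) := by
      simpa using tendsto_const_nhds.add
        (tendsto_const_nhds.div_atTop tendsto_natCast_atTop_atTop :
          Tendsto (fun x : ℕ => (1 : ℝ) / (x : ℝ)) atTop (𝓝 0))
    refine h2.congr' ?_
    filter_upwards [eventually_gt_atTop 0] with x hx
    have hx0 : (0 : ℝ) < x := by exact_mod_cast hx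
    simp only [X']
    push_cast
    field_simp
  have hmain : Tendsto (fun x : ℕ => buchstabOmega (ux x) * (X' x / (x : ℝ)) * u) atTop
      (𝓝 (buchstabOmega u * 2 * u)) := (hω.mul hX'x).mul_const u
  -- Step 3: the error terms
  have herr0 : Tendsto (fun x : ℕ => C * (X' x / (x : ℝ)) * u ^ 2) atTop (𝓝 (C * 2 * u ^ 2)) :=
    ((tendsto_const_nhds (x := C)).mul hX'x).mul_const (u ^ 2)
  have herr1 : Tendsto (fun x : ℕ => C * (X' x / (x : ℝ)) * u ^ 2 / Real.log (x : ℝ)) atTop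
      (𝓝 0) := herr0.div_atTop hlog
  have herr2 : Tendsto (fun x : ℕ => Real.log (x : ℝ) / (x : ℝ)) atTop (𝓝 0) := by
    have := (Real.tendsto_pow_log_div_mul_add_atTop 1 0 1 one_ne_zero).comp
      tendsto_natCast_atTop_atTop
    refine this.congr fun x => ?_
    simp
  -- Step 4: assemble with a squeeze on |ratio - main|
  have hgoal : Tendsto (fun x : ℕ => ratio twoXAddOne u x -
      buchstabOmega (ux x) * (X' x / (x : ℝ)) * u) atTop (𝓝 0) := by
    refine squeeze_zero_norm' ?_ (by simpa using herr1.add herr2)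
    have hev1 : ∀ᶠ x : ℕ in atTop, (2 : ℝ) ^ u < (x : ℝ) :=
      tendsto_natCast_atTop_atTop.eventually_gt_atTop _
    have hev3 : ∀ᶠ x : ℕ in atTop, (3 : ℝ) ≤ (x : ℝ) :=
      tendsto_natCast_atTop_atTop.eventually_ge_atTop _
    filter_upwards [hev1, hev3] with x hx hx3
    have hx1 : (1 : ℝ) < x := by linarith
    have hx0 : (0 : ℝ) < x := by linarith
    have hy2 : 2 < y x := by
      have : ((2 : ℝ) ^ u) ^ (1 / u) < (x : ℝ) ^ (1 / u) :=
        Real.rpow_lt_rpow (by positivity) hx (by positivity)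
      rwa [← Real.rpow_mul (by norm_num), mul_one_div_cancel hu0.ne', Real.rpow_one] at this
    have hN : 2 < ⌈(x : ℝ) ^ (1 / u)⌉₊ := Nat.lt_ceil.mpr (by exact_mod_cast hy2)
    have hyu : (y x) ^ u = x := by
      simp only [y]; rw [← Real.rpow_mul hx0.le, one_div_mul_cancel hu0.ne', Real.rpow_one]
    have hX'ge : (x : ℝ) ≤ X' x := by simp only [X']; push_cast; linarith
    have hy2X : (y x) ^ 2 ≤ X' x := by
      have h1y : 1 ≤ y x := by linarith
      calc (y x) ^ 2 = (y x) ^ (2 : ℝ) := by norm_cast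
        _ ≤ (y x) ^ u := Real.rpow_le_rpow_of_exponent_le h1y hu
        _ = x := hyu
        _ ≤ X' x := hX'ge
    have hXyU : X' x ≤ (y x) ^ (2 * u) := by
      rw [show (2 : ℝ) * u = u * 2 by ring, Real.rpow_mul (by positivity : (0 : ℝ) ≤ y x), hyu,
        Real.rpow_two]
      simp only [X']
      push_cast
      nlinarith
    have key := hC (X' x) (y x) hy2.le hy2X hXyU
    have hfloor : ⌊X' x⌋₊ = 2 * x + 1 := by simp only [X']; exact Nat.floor_natCast _
    rw [hfloor] at key
    have hcount := roughCount_twoXAddOne hN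
    -- ratio = (card - 1) * log x / x
    have hlogy : Real.log (y x) = Real.log x / u := by
      simp only [y]; rw [Real.log_rpow hx0]; ring
    have hlogx : 0 < Real.log x := Real.log_pos hx1
    have hlogy0 : 0 < Real.log (y x) := by rw [hlogy]; positivity
    have hcardR : (roughCount twoXAddOne u x : ℝ) =
        ((roughIcc ⌈y x⌉₊ (2 * x + 1)).card : ℝ) - 1 := by
      have : ((roughCount twoXAddOne u x + 1 : ℕ) : ℝ) =
          ((roughIcc ⌈(x : ℝ) ^ (1 / u)⌉₊ (2 * x + 1)).card : ℝ) := by exact_mod_cast hcount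
      push_cast at this
      simp only [y]
      linarith
    rw [Real.norm_eq_abs]
    unfold ratio
    rw [pow_one, hcardR]
    -- |(card - 1) log x / x - ω(u_x) (X'/x) u| ≤ (log x / x)|card - ω X'/log y| + log x / x
    have e1 : (((roughIcc ⌈y x⌉₊ (2 * x + 1)).card : ℝ) - 1) * Real.log x / x -
        buchstabOmega (ux x) * (X' x / x) * u =
        ((((roughIcc ⌈y x⌉₊ (2 * x + 1)).card : ℝ) -
          buchstabOmega (ux x) * X' x / Real.log (y x)) * (Real.log x / x)) - Real.log x / x := by
      simp only [ux]
      rw [hlogy]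
      field_simp
      ring
    rw [e1]
    calc |(((roughIcc ⌈y x⌉₊ (2 * x + 1)).card : ℝ) -
            buchstabOmega (ux x) * X' x / Real.log (y x)) * (Real.log x / x) - Real.log x / x|
        ≤ |(((roughIcc ⌈y x⌉₊ (2 * x + 1)).card : ℝ) -
            buchstabOmega (ux x) * X' x / Real.log (y x)) * (Real.log x / x)| + |Real.log x / x| :=
          abs_sub _ _
      _ = |((roughIcc ⌈y x⌉₊ (2 * x + 1)).card : ℝ) -
            buchstabOmega (ux x) * X' x / Real.log (y x)| * (Real.log x / x) + Real.log x / x := by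
          rw [abs_mul, abs_of_pos (by positivity : 0 < Real.log x / x)]
      _ ≤ C * X' x / Real.log (y x) ^ 2 * (Real.log x / x) + Real.log x / x := by
          gcongr
      _ = C * (X' x / x) * u ^ 2 / Real.log x + Real.log x / x := by
          rw [hlogy]
          field_simp
  have := hgoal.add hmain
  simp only [sub_add_cancel, zero_add] at this
  convert this using 2
  ring

/-- The `2X+1` rung of the crux: `Conclusion (2X+1) buchstabOmega` with `A = 2 = C(2X+1)`. -/
theorem conclusion_twoXAddOne : Conclusion twoXAddOne buchstabOmega :=
  ⟨2, fun u hu => by simpa using tendsto_ratio_twoXAddOne u hu.le⟩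


/-! ### Systems whose rough-value count is eventually bounded satisfy the conclusion with `A = 0` -/

/-- The normalised ratio is non-negative. -/
theorem ratio_nonneg {k : ℕ} (f : Fin k → ℤ[X]) (u : ℝ) (x : ℕ) : 0 ≤ ratio f u x :=
  div_nonneg (mul_nonneg (Nat.cast_nonneg _) (pow_nonneg (Real.log_natCast_nonneg x) k))
    (Nat.cast_nonneg _)

/-- If for every `u > 2` the count `Φ_f(x,u)` is eventually bounded, the conclusion of the crux
holds with `A = 0` (for ANY `ω`). -/
theorem conclusion_of_roughCount_eventually_le {k : ℕ} (f : Fin k → ℤ[X]) (ω : ℝ → ℝ)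
    (h : ∀ u : ℝ, 2 < u → ∃ N : ℕ, ∀ᶠ x : ℕ in atTop, roughCount f u x ≤ N) :
    Conclusion f ω := by
  refine ⟨0, fun u hu => ?_⟩
  obtain ⟨N, hN⟩ := h u hu
  rw [zero_mul]
  have hlim : Tendsto (fun x : ℕ => (N : ℝ) * (Real.log x ^ k / (1 * (x : ℝ) + 0))) atTop
      (𝓝 0) := by
    have := (Real.tendsto_pow_log_div_mul_add_atTop 1 0 k one_ne_zero).comp
      tendsto_natCast_atTop_atTop
    simpa using this.const_mul (N : ℝ)
  refine squeeze_zero' (Eventually.of_forall fun x => ratio_nonneg f u x) ?_ hlim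
  filter_upwards [hN] with x hx
  unfold ratio
  rw [one_mul, add_zero, mul_div_assoc]
  have h0 : 0 ≤ Real.log x ^ k / (x : ℝ) :=
    div_nonneg (pow_nonneg (Real.log_natCast_nonneg x) k) (Nat.cast_nonneg _)
  have hx' : (roughCount f u x : ℝ) ≤ N := by exact_mod_cast hx
  exact mul_le_mul_of_nonneg_right hx' h0

/-! ### `leadingCoeff_pos` is NOT load-bearing -/

/-- A polynomial with negative leading coefficient is eventually non-positive on `ℕ`. -/
theorem exists_eval_nonpos_of_leadingCoeff_neg (P : ℤ[X]) (h : P.leadingCoeff < 0) :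
    ∃ N : ℕ, ∀ n : ℕ, N ≤ n → P.eval (n : ℤ) ≤ 0 := by
  by_cases hdeg : P.natDegree = 0
  · refine ⟨0, fun n _ => ?_⟩
    have hlc : P.leadingCoeff = P.coeff 0 := by rw [leadingCoeff, hdeg]
    rw [eq_C_of_natDegree_eq_zero hdeg, eval_C]
    linarith
  · set Q : ℝ[X] := P.map (Int.castRingHom ℝ) with hQ
    have hQdeg : 0 < Q.degree := by
      rw [hQ, degree_map_eq_of_injective Int.cast_injective]
      exact natDegree_pos_iff_degree_pos.mp (Nat.pos_of_ne_zero hdeg)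
    have hQlc : Q.leadingCoeff ≤ 0 := by
      rw [hQ, leadingCoeff_map_of_injective Int.cast_injective]
      simp only [eq_intCast]
      exact_mod_cast h.le
    have ht := (Q.tendsto_atBot_of_leadingCoeff_nonpos hQdeg hQlc).comp tendsto_natCast_atTop_atTop
    obtain ⟨N, hN⟩ := eventually_atTop.mp (ht.eventually (eventually_le_atBot 0))
    refine ⟨N, fun n hn => ?_⟩
    have h1 : Q.eval (n : ℝ) ≤ 0 := hN n hn
    have h2 : Q.eval (n : ℝ) = ((P.eval (n : ℤ) : ℤ) : ℝ) := by
      rw [hQ, show ((n : ℕ) : ℝ) = ((n : ℤ) : ℝ) by simp, eval_intCast_map, eq_intCast,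
        Int.cast_id]
    rw [h2] at h1
    exact_mod_cast h1

/-- If some `fᵢ` has negative leading coefficient, the conclusion of the crux holds with `A = 0`
(the positivity guard `0 < fᵢ(n)` empties the count): `leadingCoeff_pos` is not load-bearing. -/
theorem conclusion_of_leadingCoeff_neg {k : ℕ} (f : Fin k → ℤ[X]) (i : Fin k)
    (hi : (f i).leadingCoeff < 0) (ω : ℝ → ℝ) : Conclusion f ω := by
  apply conclusion_of_roughCount_eventually_le
  intro u _
  obtain ⟨N, hN⟩ := exists_eval_nonpos_of_leadingCoeff_neg (f i) hi
  refine ⟨N, Eventually.of_forall fun x => ?_⟩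
  unfold roughCount
  calc _ ≤ (Finset.range N).card := by
        refine Finset.card_le_card fun n hn => ?_
        rw [Finset.mem_filter] at hn
        rw [Finset.mem_range]
        by_contra hlt
        have := (hn.2 i).1
        linarith [hN n (not_lt.mp hlt)]
    _ = N := Finset.card_range N

/-! ### A fixed prime divisor makes the conclusion TRUE with `A = 0` (non-constant systems) -/

/-- `¬ HasNoFixedPrimeDivisor f` gives a prime dividing `∏ fᵢ(n)` for EVERY integer `n`. -/
theorem exists_fixed_prime {k : ℕ} {f : Fin k → ℤ[X]} (h : ¬ HasNoFixedPrimeDivisor f) :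
    ∃ p : ℕ, p.Prime ∧ ∀ n : ℤ, (p : ℤ) ∣ ∏ i, (f i).eval n := by
  simp only [HasNoFixedPrimeDivisor, not_forall, not_lt] at h
  obtain ⟨p, hp, hle⟩ := h
  refine ⟨p, hp, fun n => ?_⟩
  have hall : ∀ m ∈ Finset.range p, (p : ℤ) ∣ ∏ i, (f i).eval (m : ℤ) := by
    have hsub : (Finset.range p).filter (fun m : ℕ => (p : ℤ) ∣ ∏ i, (f i).eval (m : ℤ)) =
        Finset.range p :=
      Finset.eq_of_subset_of_card_le (Finset.filter_subset _ _)
        (by simpa [polyRootCountMod] using hle)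
    intro m hm
    rw [← hsub] at hm
    exact (Finset.mem_filter.mp hm).2
  have hp0 : (0 : ℤ) < p := by exact_mod_cast hp.pos
  set m : ℕ := (n % p).toNat with hmdef
  have hm : (m : ℤ) = n % p := Int.toNat_of_nonneg (Int.emod_nonneg _ hp0.ne')
  have hmp : m < p := by
    have : (m : ℤ) < p := by rw [hm]; exact Int.emod_lt_of_pos _ hp0
    exact_mod_cast this
  have h1 := hall m (Finset.mem_range.mpr hmp)
  have h2 : (p : ℤ) ∣ n - m := by
    rw [hm]
    exact Int.dvd_self_sub_emod
  have h3 : n - m ∣ (∏ i, f i).eval n - (∏ i, f i).eval (m : ℤ) := sub_dvd_eval_sub _ _ _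
  rw [eval_prod, eval_prod] at h3
  exact (dvd_iff_dvd_of_dvd_sub (h2.trans h3)).mpr h1

/-- With a fixed prime divisor `p` and all degrees `≥ 1`, the count is `0` as soon as
`x^{1/u} > p`. -/
theorem roughCount_eq_zero_of_fixed_prime {k : ℕ} {f : Fin k → ℤ[X]}
    (hdeg : ∀ i, 0 < (f i).natDegree) {p : ℕ} (hp : p.Prime)
    (hfix : ∀ n : ℤ, (p : ℤ) ∣ ∏ i, (f i).eval n) {u : ℝ} (hu : 0 < u) {x : ℕ}
    (hx : (p : ℝ) < (x : ℝ) ^ (1 / u)) : roughCount f u x = 0 := by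
  unfold roughCount
  rw [Finset.card_eq_zero, Finset.filter_eq_empty_iff]
  intro n hn hgood
  rw [Finset.mem_Icc] at hn
  have hx1 : (1 : ℝ) ≤ x := by exact_mod_cast hn.1.trans hn.2
  obtain ⟨i, -, hi⟩ := (Nat.prime_iff_prime_int.mp hp).exists_mem_finset_dvd (hfix n)
  refine (hgood i).2 p ?_ hp hi
  rw [Finset.mem_range]
  refine Nat.lt_ceil.mpr (hx.trans_le ?_)
  refine Real.rpow_le_rpow_of_exponent_le hx1 ?_
  rw [div_le_div_iff_of_pos_right hu]
  exact_mod_cast hdeg i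

/-- **`hasNoFixedPrimeDivisor` is load-bearing only against constants**: a system of
non-constant polynomials WITH a fixed prime divisor satisfies the conclusion of the crux, with
`A = 0`, for every `ω`. -/
theorem conclusion_of_not_hasNoFixedPrimeDivisor {k : ℕ} (f : Fin k → ℤ[X])
    (hdeg : ∀ i, 0 < (f i).natDegree) (h : ¬ HasNoFixedPrimeDivisor f) (ω : ℝ → ℝ) :
    Conclusion f ω := by
  obtain ⟨p, hp, hfix⟩ := exists_fixed_prime h
  apply conclusion_of_roughCount_eventually_le
  intro u hu
  have hu0 : 0 < u := by linarith
  refine ⟨0, ?_⟩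
  have ht : Tendsto (fun x : ℕ => (x : ℝ) ^ (1 / u)) atTop atTop :=
    (tendsto_rpow_atTop (by positivity)).comp tendsto_natCast_atTop_atTop
  filter_upwards [ht.eventually_gt_atTop (p : ℝ)] with x hx
  rw [roughCount_eq_zero_of_fixed_prime hdeg hp hfix hu0 hx]

/-! ### The empty system (`k = 0`) satisfies the conclusion with `A = 1` -/

/-- The empty system sifts nothing: its count is `x`. -/
theorem roughCount_fin_zero (f : Fin 0 → ℤ[X]) (u : ℝ) (x : ℕ) : roughCount f u x = x := by
  unfold roughCount
  rw [Finset.filter_true_of_mem (fun n _ => fun i => Fin.elim0 i), Nat.card_Icc]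
  omega

/-- DEGENERATE CASE `k = 0`: the conclusion holds with `A = 1` (ratio `≡ 1`). -/
theorem conclusion_fin_zero (f : Fin 0 → ℤ[X]) (ω : ℝ → ℝ) : Conclusion f ω := by
  refine ⟨1, fun u _ => ?_⟩
  rw [pow_zero, mul_one]
  refine (tendsto_const_nhds (x := (1 : ℝ))).congr' ?_
  filter_upwards [eventually_gt_atTop 0] with x hx
  unfold ratio
  rw [roughCount_fin_zero, pow_zero, mul_one, div_self]
  exact_mod_cast hx.ne'

/-- The empty system IS a Bateman–Horn system (so `k = 0` is a genuine, true, instance). -/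
theorem isBatemanHornSystem_fin_zero (f : Fin 0 → ℤ[X]) : IsBatemanHornSystem f where
  irreducible i := Fin.elim0 i
  leadingCoeff_pos i := Fin.elim0 i
  pairwise_not_associated := Subsingleton.pairwise
  hasNoFixedPrimeDivisor p hp := by
    unfold polyRootCountMod
    rw [Finset.filter_false_of_mem, Finset.card_empty]
    · exact hp.pos
    · intro n _
      simp only [Finset.univ_eq_empty, Finset.prod_empty]
      exact_mod_cast hp.not_dvd_one


/-! ### Witness systems `(X)`, `(X, X)`, `(X, X²)`, `(2)` -/

/-- `ω_f(p) < p` as soon as `0` is the only root of `∏ fᵢ` among `0, …, p-1`. -/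
theorem polyRootCountMod_lt_of_forall_eq_zero {k : ℕ} (f : Fin k → ℤ[X]) {p : ℕ} (hp : p.Prime)
    (h : ∀ n : ℕ, n < p → (p : ℤ) ∣ ∏ i, (f i).eval (n : ℤ) → n = 0) :
    polyRootCountMod f p < p := by
  unfold polyRootCountMod
  calc _ ≤ ({0} : Finset ℕ).card := by
        refine Finset.card_le_card fun n hn => ?_
        rw [Finset.mem_filter, Finset.mem_range] at hn
        rw [Finset.mem_singleton]
        exact h n hn.1 hn.2
    _ = 1 := Finset.card_singleton 0
    _ < p := hp.one_lt

/-- `(X)` is a Bateman–Horn system. -/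
theorem isBatemanHornSystem_X : IsBatemanHornSystem ![(X : ℤ[X])] where
  irreducible i := by fin_cases i; exact irreducible_X
  leadingCoeff_pos i := by fin_cases i; simp
  pairwise_not_associated := Subsingleton.pairwise
  hasNoFixedPrimeDivisor p hp := by
    refine polyRootCountMod_lt_of_forall_eq_zero _ hp fun n hn hdvd => ?_
    have e : ∏ i, ((![(X : ℤ[X])]) i).eval (n : ℤ) = n := by simp
    rw [e] at hdvd
    exact Nat.eq_zero_of_dvd_of_lt (Int.natCast_dvd_natCast.mp hdvd) hn

/-- `(X, X)` has no fixed prime divisor. -/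
theorem hasNoFixedPrimeDivisor_X_X : HasNoFixedPrimeDivisor ![(X : ℤ[X]), X] := fun p hp => by
  refine polyRootCountMod_lt_of_forall_eq_zero _ hp fun n hn hdvd => ?_
  have e : ∏ i, ((![(X : ℤ[X]), X]) i).eval (n : ℤ) = n * n := by simp [Fin.prod_univ_two]
  rw [e] at hdvd
  have : (p : ℤ) ∣ (n : ℤ) := (Int.Prime.dvd_mul' hp hdvd).elim id id
  exact Nat.eq_zero_of_dvd_of_lt (Int.natCast_dvd_natCast.mp this) hn

/-- `(X, X²)` has no fixed prime divisor. -/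
theorem hasNoFixedPrimeDivisor_X_Xsq : HasNoFixedPrimeDivisor ![(X : ℤ[X]), X ^ 2] :=
  fun p hp => by
  refine polyRootCountMod_lt_of_forall_eq_zero _ hp fun n hn hdvd => ?_
  have e : ∏ i, ((![(X : ℤ[X]), X ^ 2]) i).eval (n : ℤ) = (n : ℤ) ^ 3 := by
    simp [Fin.prod_univ_two]; ring
  rw [e] at hdvd
  have : (p : ℤ) ∣ (n : ℤ) := Int.Prime.dvd_pow' hp hdvd
  exact Nat.eq_zero_of_dvd_of_lt (Int.natCast_dvd_natCast.mp this) hn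

/-- `X` and `X²` are not associated (degrees differ). -/
theorem not_associated_X_Xsq : ¬ Associated (X : ℤ[X]) (X ^ 2) := fun h => by
  have := natDegree_eq_of_degree_eq (degree_eq_degree_of_associated h)
  simp at this

/-- `(X, X²)` is pairwise non-associated. -/
theorem pairwise_not_associated_X_Xsq :
    Pairwise fun i j => ¬ Associated ((![(X : ℤ[X]), X ^ 2]) i) ((![(X : ℤ[X]), X ^ 2]) j) := by
  intro i j hij
  fin_cases i <;> fin_cases j
  · exact absurd rfl hij
  · simpa using not_associated_X_Xsq
  · simpa using fun h => not_associated_X_Xsq (Associated.symm h)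
  · exact absurd rfl hij

/-- Irreducible constants of `ℤ[X]` (copy of the tree's `irreducible_C_of_irreducible`,
`BertiniSubstitutionProofs.lean`, to keep the imports light). -/
theorem irreducible_C_of_irreducible' {r : ℤ} (hr : Irreducible r) :
    Irreducible (Polynomial.C r) := by
  refine ⟨fun hu ↦ hr.not_isUnit (Polynomial.isUnit_C.1 hu), fun p q hpq ↦ ?_⟩
  have hr0 : r ≠ 0 := hr.ne_zero
  have hp0 : p ≠ 0 := fun h ↦ by rw [h, zero_mul] at hpq; exact hr0 (Polynomial.C_eq_zero.1 hpq)
  have hq0 : q ≠ 0 := fun h ↦ by rw [h, mul_zero] at hpq; exact hr0 (Polynomial.C_eq_zero.1 hpq)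
  have hdeg : p.natDegree + q.natDegree = 0 := by
    rw [← Polynomial.natDegree_mul hp0 hq0, ← hpq, Polynomial.natDegree_C]
  have hp : p = Polynomial.C (p.coeff 0) := Polynomial.eq_C_of_natDegree_eq_zero (by omega)
  have hq : q = Polynomial.C (q.coeff 0) := Polynomial.eq_C_of_natDegree_eq_zero (by omega)
  rw [hp, hq, ← map_mul] at hpq
  have hab : r = p.coeff 0 * q.coeff 0 := Polynomial.C_injective hpq
  rcases hr.isUnit_or_isUnit hab with hu | hu
  · exact Or.inl (hp ▸ Polynomial.isUnit_C.2 hu)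
  · exact Or.inr (hq ▸ Polynomial.isUnit_C.2 hu)

/-- The constant `2` is irreducible in `ℤ[X]`. -/
theorem irreducible_C_two : Irreducible (C (2 : ℤ) : ℤ[X]) :=
  irreducible_C_of_irreducible' Int.prime_two.irreducible

/-- `(X, X)` sifts the same set as `(X)`. -/
theorem roughCount_X_X (u : ℝ) (x : ℕ) :
    roughCount ![(X : ℤ[X]), X] u x = roughCount ![(X : ℤ[X])] u x := by
  unfold roughCount
  congr 1
  ext n
  simp only [Finset.mem_filter, Fin.forall_fin_two, Fin.forall_fin_one, Matrix.cons_val_zero,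
    Matrix.cons_val_one, Matrix.cons_val_fin_one, and_self]

/-- `(X, X²)` sifts `n` up to `x^{2/u}`: its finset is `roughIcc ⌈x^{2/u}⌉₊ x`. -/
theorem roughCount_X_Xsq (u : ℝ) (hu : 0 < u) (x : ℕ) :
    roughCount ![(X : ℤ[X]), X ^ 2] u x = (roughIcc ⌈(x : ℝ) ^ (2 / u)⌉₊ x).card := by
  unfold roughCount
  congr 1
  ext n
  simp only [Finset.mem_filter, Fin.forall_fin_two, Matrix.cons_val_zero, Matrix.cons_val_one,
    eval_X, eval_pow, natDegree_X, natDegree_X_pow, Nat.cast_one, Nat.cast_ofNat, mem_roughIcc,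
    Finset.mem_Icc]
  have hpow : ∀ N : ℕ, (∀ p ∈ Finset.range N, p.Prime → ¬ ((p : ℤ) ∣ (n : ℤ) ^ 2)) ↔
      (∀ p ∈ Finset.range N, p.Prime → ¬ ((p : ℤ) ∣ (n : ℤ))) := fun N => by
    refine forall₂_congr fun p _ => ?_
    refine imp_congr_right fun hp => not_congr ⟨fun h => Int.Prime.dvd_pow' hp h, fun h => ?_⟩
    exact dvd_pow h two_ne_zero
  rw [hpow, forall_range_prime_not_dvd_iff, forall_range_prime_not_dvd_iff]
  constructor
  · rintro ⟨hn, -, -, h2⟩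
    exact ⟨hn, h2⟩
  · rintro ⟨hn, h2⟩
    have hx1 : (1 : ℝ) ≤ x := by exact_mod_cast hn.1.trans hn.2
    have hn0 : (0 : ℤ) < n := by exact_mod_cast hn.1
    refine ⟨hn, ⟨hn0, fun p hp hpn => ?_⟩, ⟨by positivity, h2⟩⟩
    refine le_trans (Nat.ceil_mono ?_) (h2 p hp hpn)
    refine Real.rpow_le_rpow_of_exponent_le hx1 ?_
    rw [div_le_div_iff_of_pos_right hu]
    norm_num

/-- The constant system `(2)` sifts nothing (`x^{0/u} = 1`): its count is `x`. -/
theorem roughCount_C_two (u : ℝ) (x : ℕ) : roughCount ![(C 2 : ℤ[X])] u x = x := by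
  unfold roughCount
  rw [Finset.filter_true_of_mem, Nat.card_Icc, Nat.add_sub_cancel]
  intro n _ i
  fin_cases i
  simp only [Matrix.cons_val_fin_one, eval_C, natDegree_C, Nat.cast_zero, zero_div,
    Real.rpow_zero, Nat.ceil_one, Finset.range_one, Finset.mem_singleton]
  refine ⟨by norm_num, fun p hp hprime => ?_⟩
  subst hp
  exact (Nat.not_prime_zero hprime).elim

/-- `log x → ∞` along `ℕ`. -/
theorem tendsto_log_natCast_atTop : Tendsto (fun x : ℕ => Real.log (x : ℝ)) atTop atTop :=
  Real.tendsto_log_atTop.comp tendsto_natCast_atTop_atTop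

/-- `uω(u) > 0` for `u ≥ 1` (`ω ≥ 1/2`). -/
theorem mul_buchstabOmega_pos {u : ℝ} (hu : 1 ≤ u) : 0 < u * buchstabOmega u :=
  mul_pos (by linarith) (lt_of_lt_of_le (by norm_num) (half_le_buchstabOmega hu))

/-- TIGHTNESS on `(2,3]`: the `f = X` ratio tends to the explicit `1 + log(u-1)`. -/
theorem tendsto_ratio_X_explicit {u : ℝ} (hu : 2 < u) (hu3 : u ≤ 3) :
    Tendsto (ratio ![(X : ℤ[X])] u) atTop (𝓝 (1 + Real.log (u - 1))) := by
  have h := tendsto_ratio_X u hu.le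
  rw [buchstabOmega_eq_of_mem_Icc_two_three hu.le hu3, mul_div_cancel₀ _ (by linarith : u ≠ 0)]
    at h
  exact h

/-- `(X, X)`: ratio `= Φ(x,x^{1/u}) (log x)²/x ~ uω(u) log x → ∞`. -/
theorem tendsto_ratio_X_X_atTop (u : ℝ) (hu : 2 ≤ u) :
    Tendsto (ratio ![(X : ℤ[X]), X] u) atTop atTop := by
  have h := (tendsto_ratio_X u hu).pos_mul_atTop (mul_buchstabOmega_pos (by linarith))
    tendsto_log_natCast_atTop
  refine h.congr fun x => ?_
  simp only [ratio, roughCount_X_X]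
  ring

/-- `(X, X²)` at `u = 4`: ratio `= Φ(x,√x) (log x)²/x ~ log x → ∞`. -/
theorem tendsto_ratio_X_Xsq_four_atTop : Tendsto (ratio ![(X : ℤ[X]), X ^ 2] 4) atTop atTop := by
  have h := (tendsto_card_roughIcc_mul_log_div 2 le_rfl).pos_mul_atTop
    (mul_buchstabOmega_pos (by norm_num)) tendsto_log_natCast_atTop
  refine h.congr fun x => ?_
  simp only [ratio, roughCount_X_Xsq 4 (by norm_num : (0:ℝ) < 4)]
  rw [show (2 : ℝ) / 4 = 1 / 2 by norm_num]
  push_cast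
  ring

/-- `(2)`: ratio `= log x → ∞`. -/
theorem tendsto_ratio_C_two_atTop (u : ℝ) : Tendsto (ratio ![(C 2 : ℤ[X])] u) atTop atTop := by
  refine tendsto_log_natCast_atTop.congr' ?_
  filter_upwards [eventually_gt_atTop 0] with x hx
  simp only [ratio, roughCount_C_two, pow_one]
  rw [mul_div_cancel_left₀ _ (by exact_mod_cast hx.ne' : (x : ℝ) ≠ 0)]

/-! ### (a) Load-bearing analysis: the system hypotheses -/

/-- The crux with `pairwise_not_associated` DROPPED from `IsBatemanHornSystem`. -/
def RoughValueLawWithoutNonAssociated : Prop :=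
  ∀ (k : ℕ) (f : Fin k → ℤ[X]), (∀ i, Irreducible (f i)) → (∀ i, 0 < (f i).leadingCoeff) →
    HasNoFixedPrimeDivisor f → ∀ ω : ℝ → ℝ, IsBuchstab ω → Conclusion f ω

/-- Any proof of `RoughValueLaw` must use `pairwise_not_associated`: the duplicated system
`(X, X)` is irreducible, monic, without fixed prime divisor, and its normalised count
`Φ(x, x^{1/u}) (log x)²/x ~ uω(u) log x` diverges. -/
theorem roughValueLaw_false_without_nonAssociated : ¬ RoughValueLawWithoutNonAssociated := by
  intro h
  obtain ⟨A, hA⟩ := h 2 ![X, X] (fun i => by fin_cases i <;> exact irreducible_X)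
    (fun i => by fin_cases i <;> simp) hasNoFixedPrimeDivisor_X_X buchstabOmega
    isBuchstab_buchstabOmega
  exact not_tendsto_nhds_of_tendsto_atTop (tendsto_ratio_X_X_atTop 3 (by norm_num)) _
    (hA 3 (by norm_num))

/-- The crux with `irreducible` DROPPED from `IsBatemanHornSystem`. -/
def RoughValueLawWithoutIrreducible : Prop :=
  ∀ (k : ℕ) (f : Fin k → ℤ[X]), (∀ i, 0 < (f i).leadingCoeff) →
    (Pairwise fun i j => ¬ Associated (f i) (f j)) → HasNoFixedPrimeDivisor f →
    ∀ ω : ℝ → ℝ, IsBuchstab ω → Conclusion f ω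

/-- Any proof of `RoughValueLaw` must use `irreducible`: `(X, X²)` is monic, pairwise
non-associated, without fixed prime divisor, and at `u = 4` its count is `Φ(x, √x) ≍ x/log x`, so
the normalised ratio `≍ log x` diverges. -/
theorem roughValueLaw_false_without_irreducible : ¬ RoughValueLawWithoutIrreducible := by
  intro h
  obtain ⟨A, hA⟩ := h 2 ![X, X ^ 2] (fun i => by fin_cases i <;> simp)
    pairwise_not_associated_X_Xsq hasNoFixedPrimeDivisor_X_Xsq buchstabOmega
    isBuchstab_buchstabOmega
  exact not_tendsto_nhds_of_tendsto_atTop tendsto_ratio_X_Xsq_four_atTop _ (hA 4 (by norm_num))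

/-! ### What `irreducible` really guards: the squarefree reducible `X(X+2)` is harmless -/

/-- The prime-pair polynomial `X(X+2)` as a one-member family. -/
noncomputable abbrev pairPoly : Fin 1 → ℤ[X] := ![X * (X + C 2)]

/-- `deg X(X+2) = 2`. -/
theorem natDegree_pairPoly : (X * (X + C (2 : ℤ)) : ℤ[X]).natDegree = 2 := by
  compute_degree!

/-- The crux's count for `X(X+2)` at depth `u` is at most the pair-rough count at level
`z = x^{2/max(u,4)} ≤ min(x^{2/u}, √x)`. -/
theorem roughCount_pairPoly_le (u : ℝ) (hu : 2 < u) (x : ℕ) :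
    roughCount pairPoly u x ≤
      #((Ioc 0 x).filter fun n : ℕ => n.Coprime (primesProdBelow ((x : ℝ) ^ (2 / max u 4))) ∧
        (n + 2).Coprime (primesProdBelow ((x : ℝ) ^ (2 / max u 4)))) := by
  unfold roughCount
  refine Finset.card_le_card fun n hn => ?_
  rw [Finset.mem_filter, Finset.mem_Icc] at hn
  obtain ⟨⟨hn1, hnx⟩, hgood⟩ := hn
  obtain ⟨-, hsift⟩ := hgood 0
  simp only [pairPoly, Matrix.cons_val_fin_one, natDegree_pairPoly, Nat.cast_ofNat, eval_mul,
    eval_X, eval_add, eval_C] at hsift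
  have hx1 : (1 : ℝ) ≤ x := by exact_mod_cast hn1.trans hnx
  have hz : (x : ℝ) ^ (2 / max u 4) ≤ (x : ℝ) ^ ((2 : ℝ) / u) := by
    refine Real.rpow_le_rpow_of_exponent_le hx1 ?_
    exact div_le_div_of_nonneg_left (by norm_num) (by linarith) (le_max_left u 4)
  have hkey : ∀ q : ℕ, q ∈ Nat.primesBelow ⌈(x : ℝ) ^ (2 / max u 4)⌉₊ → ¬ (q ∣ n * (n + 2)) := by
    intro q hq hdvd
    rw [Nat.mem_primesBelow] at hq
    refine hsift q (Finset.mem_range.mpr (lt_of_lt_of_le hq.1 (Nat.ceil_mono hz))) hq.2 ?_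
    exact_mod_cast hdvd
  rw [Finset.mem_filter, Finset.mem_Ioc, coprime_primesProdBelow_iff, coprime_primesProdBelow_iff]
  refine ⟨⟨hn1, hnx⟩, fun q hq hqn => hkey q hq (hqn.mul_right _), fun q hq hqn =>
    hkey q hq (hqn.mul_left _)⟩

/-- The normalised count of `X(X+2)` tends to `0` at every depth `u > 2`: the two-dimensional
upper-bound sieve (tree theorem `PairRough.card_pair_rough_le`) gives `≪ x/log² x`, one logarithm
more than the crux's normalisation `(log x)^1` for a ONE-member family. -/
theorem tendsto_ratio_pairPoly (u : ℝ) (hu : 2 < u) : Tendsto (ratio pairPoly u) atTop (𝓝 0) := by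
  obtain ⟨C, hC0, hC⟩ := PairRough.card_pair_rough_le
  set v : ℝ := max u 4 with hv
  have hv4 : 4 ≤ v := le_max_right _ _
  have hv0 : 0 < v := by linarith
  set K : ℝ := C * v ^ 2 / 2 with hK
  have hlim : Tendsto (fun x : ℕ => K / Real.log (x : ℝ)) atTop (𝓝 0) := by
    have := (Real.tendsto_log_atTop.comp tendsto_natCast_atTop_atTop).inv_tendsto_atTop
    simpa [div_eq_mul_inv] using this.const_mul K
  refine squeeze_zero' (Eventually.of_forall fun x => ratio_nonneg _ u x) ?_ hlim
  have hev : ∀ᶠ x : ℕ in atTop, (2 : ℝ) ^ (v / 2) ≤ (x : ℝ) :=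
    tendsto_natCast_atTop_atTop.eventually_ge_atTop _
  filter_upwards [hev] with x hx
  set z : ℝ := (x : ℝ) ^ (2 / v) with hz
  have hx1 : (1 : ℝ) < x := lt_of_lt_of_le (Real.one_lt_rpow (by norm_num) (by positivity)) hx
  have hx0 : (0 : ℝ) < x := by linarith
  have hz2 : 2 ≤ z := by
    have : ((2 : ℝ) ^ (v / 2)) ^ (2 / v) ≤ (x : ℝ) ^ (2 / v) :=
      Real.rpow_le_rpow (by positivity) hx (by positivity)
    rwa [← Real.rpow_mul (by norm_num), show v / 2 * (2 / v) = 1 by field_simp, Real.rpow_one]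
      at this
  have hzx : z ^ 2 ≤ (x : ℝ) := by
    rw [hz, ← Real.rpow_natCast ((x : ℝ) ^ (2 / v)) 2, ← Real.rpow_mul hx0.le]
    calc (x : ℝ) ^ (2 / v * (2 : ℕ)) ≤ (x : ℝ) ^ (1 : ℝ) := by
          refine Real.rpow_le_rpow_of_exponent_le hx1.le ?_
          rw [div_mul_eq_mul_div, div_le_one hv0]
          push_cast
          linarith
      _ = x := Real.rpow_one _
  have hlogz : Real.log z = 2 / v * Real.log x := by rw [hz, Real.log_rpow hx0]
  have hlogx : 0 < Real.log x := Real.log_pos hx1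
  have hcount := hC 2 even_two (by norm_num) x z hz2 hzx
  rw [Nat.totient_two] at hcount
  have h1 : (roughCount pairPoly u x : ℝ) ≤ C * 2 * x / Real.log z ^ 2 := by
    have := roughCount_pairPoly_le u hu x
    rw [← hv] at this
    calc (roughCount pairPoly u x : ℝ) ≤ _ := by exact_mod_cast this
      _ ≤ C * ((2 : ℕ) / ((1 : ℕ) : ℝ)) * x / Real.log z ^ 2 := hcount
      _ = C * 2 * x / Real.log z ^ 2 := by norm_num
  unfold ratio
  rw [pow_one]
  calc (roughCount pairPoly u x : ℝ) * Real.log x / x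
      ≤ C * 2 * x / Real.log z ^ 2 * Real.log x / x := by gcongr
    _ = K / Real.log x := by
        rw [hlogz, hK]
        field_simp

/-- **The reducible SQUAREFREE member `X(X+2)` satisfies the conclusion of the crux (with
`A = 0`)**, although it violates `irreducible`: its count is two-dimensional while the
normalisation of a one-member family is `(log x)^1`. So `irreducible` is load-bearing only through
NON-squarefree members (`(X, X²)`, `roughValueLaw_false_without_irreducible`): the data a proof
consumes are the distinct irreducible factors of `∏ fᵢ` and their degrees. -/
theorem conclusion_pairPoly (ω : ℝ → ℝ) : Conclusion pairPoly ω :=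
  ⟨0, fun u hu => by simpa using tendsto_ratio_pairPoly u hu⟩


/-- The crux with `hasNoFixedPrimeDivisor` DROPPED from `IsBatemanHornSystem`. -/
def RoughValueLawWithoutNoFixedPrimeDivisor : Prop :=
  ∀ (k : ℕ) (f : Fin k → ℤ[X]), (∀ i, Irreducible (f i)) → (∀ i, 0 < (f i).leadingCoeff) →
    (Pairwise fun i j => ¬ Associated (f i) (f j)) → ∀ ω : ℝ → ℝ, IsBuchstab ω → Conclusion f ω

/-- Without `hasNoFixedPrimeDivisor` the irreducible CONSTANT `2` is admitted; it sifts nothing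
(`x^{0/u} = 1`) and its ratio is `log x → ∞`. By `conclusion_of_not_hasNoFixedPrimeDivisor`
this is the ONLY use of the hypothesis: for non-constant systems it is not load-bearing. -/
theorem roughValueLaw_false_without_noFixedPrimeDivisor :
    ¬ RoughValueLawWithoutNoFixedPrimeDivisor := by
  intro h
  obtain ⟨A, hA⟩ := h 1 ![C 2] (fun i => by fin_cases i; exact irreducible_C_two)
    (fun i => by
      fin_cases i
      show 0 < (C (2 : ℤ) : ℤ[X]).leadingCoeff
      rw [leadingCoeff_C]; norm_num)
    Subsingleton.pairwise buchstabOmega isBuchstab_buchstabOmega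
  exact not_tendsto_nhds_of_tendsto_atTop (tendsto_ratio_C_two_atTop 3) _ (hA 3 (by norm_num))

/-! ### (a') Load-bearing analysis: the inline Buchstab predicate -/

/-- The crux with the initial clause `ω = 1/u on [1,2]` DROPPED. -/
def RoughValueLawWithoutOmegaInit : Prop :=
  ∀ (k : ℕ) (f : Fin k → ℤ[X]), IsBatemanHornSystem f → ∀ ω : ℝ → ℝ,
    (ContinuousOn ω (Set.Ici 1) ∧
      ∀ u : ℝ, 2 < u → HasDerivAt (fun t : ℝ => t * ω t) (ω (u - 1)) u) → Conclusion f ω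

/-- The initial clause is load-bearing: `ω ≡ 0` satisfies the other two clauses and predicts the
limit `0` for `f = X`, whose true limit is `uω(u) > 0`. -/
theorem roughValueLaw_false_without_omegaInit : ¬ RoughValueLawWithoutOmegaInit := by
  intro h
  obtain ⟨A, hA⟩ := h 1 ![X] isBatemanHornSystem_X (fun _ => 0)
    ⟨continuousOn_const, fun u _ => by simpa using hasDerivAt_const u (0 : ℝ)⟩
  have e := tendsto_nhds_unique (tendsto_ratio_X 3 (by norm_num)) (hA 3 (by norm_num))
  have hpos := mul_buchstabOmega_pos (u := 3) (by norm_num)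
  simp at e
  linarith

/-- The crux with the delay-differential clause `(uω(u))' = ω(u-1)` (`u > 2`) DROPPED. -/
def RoughValueLawWithoutOmegaDDE : Prop :=
  ∀ (k : ℕ) (f : Fin k → ℤ[X]), IsBatemanHornSystem f → ∀ ω : ℝ → ℝ,
    ((∀ u : ℝ, 1 ≤ u → u ≤ 2 → ω u = u⁻¹) ∧ ContinuousOn ω (Set.Ici 1)) → Conclusion f ω

/-- The delay-differential clause is load-bearing: `ω(u) = 1/u` (all `u`) satisfies the other two
clauses and predicts a CONSTANT limit `A` for `f = X`, but the true limits at `u = 3` and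
`u = 5/2` are `1 + log 2 ≠ 1 + log(3/2)`. -/
theorem roughValueLaw_false_without_omegaDDE : ¬ RoughValueLawWithoutOmegaDDE := by
  intro h
  obtain ⟨A, hA⟩ := h 1 ![X] isBatemanHornSystem_X (fun u => u⁻¹)
    ⟨fun u _ _ => rfl, fun u hu => (continuousAt_inv₀ (by
      simp only [Set.mem_Ici] at hu; positivity)).continuousWithinAt⟩
  have e3 := tendsto_nhds_unique (tendsto_ratio_X_explicit (u := 3) (by norm_num) (by norm_num))
    (hA 3 (by norm_num))
  have e52 := tendsto_nhds_unique
    (tendsto_ratio_X_explicit (u := 5 / 2) (by norm_num) (by norm_num)) (hA (5 / 2) (by norm_num))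
  norm_num at e3 e52
  have h1 : Real.log 2 = Real.log (3 / 2) := by linarith
  have := Real.log_injOn_pos (Set.mem_Ioi.mpr (by norm_num)) (Set.mem_Ioi.mpr (by norm_num)) h1
  norm_num at this

/-! ### The continuity clause of the inline predicate is REDUNDANT -/

/-- With `ω = 1/u` on `[1,2]` and the delay equation `(uω(u))' = ω(u-1)` at EVERY `u > 2`
(two-sided derivative, in particular at `u = 3`), `ω` is automatically continuous on `[1,∞)`:
on `(2,3)` one has `uω(u) = log(u-1) + a`, and differentiability of `uω(u)` AT `u = 3` equates the
left derivative `ω(2) = 1/2` with the right limit `(log 1 + a)/2` of `ω(u-1)`, forcing `a = 1`,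
i.e. right-continuity at `2`. Hence the clause `ContinuousOn ω (Ici 1)` of the crux is implied by
the other two (it is NOT load-bearing, and dropping it changes nothing). -/
theorem continuousOn_of_init_of_dde {ω : ℝ → ℝ}
    (h1 : ∀ u : ℝ, 1 ≤ u → u ≤ 2 → ω u = u⁻¹)
    (h3 : ∀ u : ℝ, 2 < u → HasDerivAt (fun t : ℝ => t * ω t) (ω (u - 1)) u) :
    ContinuousOn ω (Set.Ici 1) := by
  set g : ℝ → ℝ := fun t => t * ω t with hg
  -- Step A: on (2,3), g = log(· - 1) + a
  have hA_diff : DifferentiableOn ℝ g (Set.Ioo 2 3) := fun t ht =>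
    (h3 t ht.1).differentiableAt.differentiableWithinAt
  have hlogd : ∀ t : ℝ, 2 < t → HasDerivAt (fun t : ℝ => Real.log (t - 1)) ((t - 1)⁻¹) t := by
    intro t ht
    have := ((hasDerivAt_id t).sub_const (1 : ℝ)).log (by simp; linarith)
    simpa using this
  have hlog_diff : DifferentiableOn ℝ (fun t : ℝ => Real.log (t - 1)) (Set.Ioo 2 3) := fun t ht =>
    (hlogd t ht.1).differentiableAt.differentiableWithinAt
  have hA_deriv : (Set.Ioo (2 : ℝ) 3).EqOn (deriv g) (deriv fun t : ℝ => Real.log (t - 1)) := by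
    intro t ht
    rw [(h3 t ht.1).deriv, (hlogd t ht.1).deriv, h1 (t - 1) (by linarith [ht.1]) (by linarith [ht.2])]
  obtain ⟨a, ha⟩ := isOpen_Ioo.exists_eq_add_of_deriv_eq isPreconnected_Ioo hA_diff hlog_diff
    hA_deriv
  -- Step B/C: a = 1 from the two-sided derivative at 3
  have ha1 : a = 1 := by
    have hB_diff : DifferentiableOn ℝ g (Set.Ioo 3 4) := fun t ht =>
      (h3 t (by linarith [ht.1])).differentiableAt.differentiableWithinAt
    have hcont : ContinuousWithinAt g (Set.Ioo 3 4) 3 :=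
      (h3 3 (by norm_num)).continuousAt.continuousWithinAt
    have hmem : Set.Ioo (3 : ℝ) 4 ∈ 𝓝[>] (3 : ℝ) := Ioo_mem_nhdsGT (by norm_num)
    set ψ : ℝ → ℝ := fun t => (Real.log (t - 2) + a) / (t - 1) with hψ
    have hderiv_eq : ∀ t ∈ Set.Ioo (3 : ℝ) 4, deriv g t = ψ t := by
      intro t ht
      rw [(h3 t (by linarith [ht.1])).deriv]
      have ht1 : t - 1 ∈ Set.Ioo (2 : ℝ) 3 := ⟨by linarith [ht.1], by linarith [ht.2]⟩
      have e := ha ht1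
      simp only [hg] at e
      rw [show t - 1 - 1 = t - 2 by ring] at e
      rw [hψ]
      simp only
      rw [eq_div_iff (by linarith [ht.1] : (t : ℝ) - 1 ≠ 0), mul_comm]
      exact e
    have hψc : ContinuousAt ψ 3 := by
      apply ContinuousAt.div
      · exact ((continuousAt_id.sub continuousAt_const).log (by norm_num)).add continuousAt_const
      · exact continuousAt_id.sub continuousAt_const
      · norm_num
    have hψ3 : ψ 3 = a / 2 := by
      simp only [hψ]
      norm_num
    have hψ_tendsto : Tendsto ψ (𝓝[>] 3) (𝓝 (a / 2)) := by
      rw [← hψ3]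
      exact hψc.tendsto.mono_left nhdsWithin_le_nhds
    have hderiv_tendsto : Tendsto (fun t => deriv g t) (𝓝[>] 3) (𝓝 (a / 2)) := by
      refine hψ_tendsto.congr' ?_
      filter_upwards [hmem] with t ht
      exact (hderiv_eq t ht).symm
    have hright : HasDerivWithinAt g (a / 2) (Set.Ici 3) 3 :=
      hasDerivWithinAt_Ici_of_tendsto_deriv hB_diff hcont hmem hderiv_tendsto
    have hleft : HasDerivWithinAt g (ω (3 - 1)) (Set.Ici 3) 3 := (h3 3 (by norm_num)).hasDerivWithinAt
    have huniq := (uniqueDiffOn_Ici (3 : ℝ) 3 Set.self_mem_Ici).eq_deriv _ hleft hright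
    rw [show (3 : ℝ) - 1 = 2 by norm_num, h1 2 (by norm_num) le_rfl] at huniq
    linarith
  -- Step D: continuity on [1, ∞)
  intro t ht
  rw [Set.mem_Ici] at ht
  rcases lt_trichotomy t 2 with hlt | heq | hgt
  · have hev : ω =ᶠ[𝓝[Set.Ici 1] t] fun u => u⁻¹ := by
      have : Set.Ici (1 : ℝ) ∩ Set.Iio 2 ∈ 𝓝[Set.Ici 1] t :=
        inter_mem_nhdsWithin _ (Iio_mem_nhds hlt)
      filter_upwards [this] with u hu
      exact h1 u hu.1 hu.2.le
    exact (continuousAt_inv₀ (by linarith)).continuousWithinAt.congr_of_eventuallyEq hev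
      (h1 t ht hlt.le)
  · subst heq
    have hsplit : Set.Ici (1 : ℝ) = Set.Icc 1 2 ∪ Set.Ioi 2 := by
      ext u
      simp only [Set.mem_Ici, Set.mem_union, Set.mem_Icc, Set.mem_Ioi]
      constructor
      · intro h
        rcases le_or_gt u 2 with h2 | h2
        · exact Or.inl ⟨h, h2⟩
        · exact Or.inr h2
      · rintro (h | h)
        · exact h.1
        · linarith
    rw [hsplit, continuousWithinAt_union]
    constructor
    · have hev : ω =ᶠ[𝓝[Set.Icc 1 2] 2] fun u => u⁻¹ := by
        filter_upwards [self_mem_nhdsWithin] with u hu using h1 u hu.1 hu.2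
      exact (continuousAt_inv₀ (by norm_num)).continuousWithinAt.congr_of_eventuallyEq hev
        (h1 2 (by norm_num) le_rfl)
    · have hev : ω =ᶠ[𝓝[Set.Ioi 2] 2] fun u => (Real.log (u - 1) + 1) / u := by
        filter_upwards [Ioo_mem_nhdsGT (show (2 : ℝ) < 3 by norm_num)] with u hu
        have e := ha hu
        simp only [hg] at e
        rw [ha1] at e
        rw [eq_div_iff (by linarith [hu.1] : (u : ℝ) ≠ 0), mul_comm]
        exact e
      refine ContinuousWithinAt.congr_of_eventuallyEq ?_ hev ?_
      · have hc : ContinuousAt (fun u : ℝ => (Real.log (u - 1) + 1) / u) 2 := by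
          apply ContinuousAt.div
          · exact ((continuousAt_id.sub continuousAt_const).log (by norm_num)).add
              continuousAt_const
          · exact continuousAt_id
          · norm_num
        exact hc.continuousWithinAt
      · rw [h1 2 (by norm_num) le_rfl]
        norm_num
  · have hgc : ContinuousAt g t := (h3 t hgt).continuousAt
    have hq : ContinuousAt (fun u => g u / u) t :=
      hgc.div continuousAt_id (by linarith : (0 : ℝ) < t).ne'
    have hev : ω =ᶠ[𝓝 t] fun u => g u / u := by
      filter_upwards [Ioi_mem_nhds (show (0 : ℝ) < t by linarith)] with u hu
      simp only [hg]
      rw [Set.mem_Ioi] at hu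
      field_simp
    exact (hq.congr_of_eventuallyEq hev).continuousWithinAt


/-- The inline predicate is equivalent to its first and third clauses (continuity is derived). -/
theorem isBuchstab_iff {ω : ℝ → ℝ} :
    IsBuchstab ω ↔ ((∀ u : ℝ, 1 ≤ u → u ≤ 2 → ω u = u⁻¹) ∧
      ∀ u : ℝ, 2 < u → HasDerivAt (fun t : ℝ => t * ω t) (ω (u - 1)) u) :=
  ⟨fun h => ⟨h.1, h.2.2⟩, fun h => ⟨h.1, continuousOn_of_init_of_dde h.1 h.2, h.2⟩⟩

/-- The crux with the continuity clause DROPPED (kept for the record: by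
`roughValueLawWithoutOmegaCont_iff` it is the SAME statement — the clause is not load-bearing). -/
def RoughValueLawWithoutOmegaCont : Prop :=
  ∀ (k : ℕ) (f : Fin k → ℤ[X]), IsBatemanHornSystem f → ∀ ω : ℝ → ℝ,
    ((∀ u : ℝ, 1 ≤ u → u ≤ 2 → ω u = u⁻¹) ∧
      ∀ u : ℝ, 2 < u → HasDerivAt (fun t : ℝ => t * ω t) (ω (u - 1)) u) → Conclusion f ω

/-- Dropping the continuity clause does not change the crux. -/
theorem roughValueLawWithoutOmegaCont_iff :
    RoughValueLawWithoutOmegaCont ↔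
      Summit.Parity.BatemanHorn.Theses.RoughValueTransport.RoughValueLaw := by
  rw [roughValueLaw_iff]
  unfold RoughValueLawWithoutOmegaCont
  refine forall₃_congr fun k f _ => forall_congr' fun ω => ?_
  rw [isBuchstab_iff]

/-- BOUNDARY of the predicate: with `ω = 1/u` on `[1,2]`, `u ↦ uω(u)` is constant `1` to the left
of `2`, so it cannot have derivative `ω(1) = 1` AT `u = 2`; the clause `2 < u` (strict) in the
crux is forced — a variant demanding the delay equation at `u = 2` as well quantifies over NO `ω`
and would be vacuously true. -/
theorem not_hasDerivAt_two_of_init (ω : ℝ → ℝ) (hinit : ∀ u : ℝ, 1 ≤ u → u ≤ 2 → ω u = u⁻¹) :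
    ¬ HasDerivAt (fun t : ℝ => t * ω t) (ω (2 - 1)) 2 := by
  intro h
  have h1 : HasDerivWithinAt (fun t : ℝ => t * ω t) (ω (2 - 1)) (Set.Icc 1 2) 2 :=
    h.hasDerivWithinAt
  have h0 : HasDerivWithinAt (fun t : ℝ => t * ω t) 0 (Set.Icc 1 2) 2 := by
    refine (hasDerivWithinAt_const (2 : ℝ) (Set.Icc 1 2) (1 : ℝ)).congr (fun t ht => ?_) ?_
    · rw [hinit t ht.1 ht.2, mul_inv_cancel₀ (by linarith [ht.1])]
    · rw [hinit 2 (by norm_num) le_rfl, mul_inv_cancel₀ (by norm_num)]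
  have huniq : UniqueDiffWithinAt ℝ (Set.Icc (1 : ℝ) 2) 2 :=
    uniqueDiffOn_Icc (by norm_num) 2 (Set.right_mem_Icc.mpr (by norm_num))
  have := huniq.eq_deriv _ h1 h0
  rw [show (2 : ℝ) - 1 = 1 by norm_num, hinit 1 le_rfl (by norm_num)] at this
  norm_num at this


/-! ### (b) Boundary: the free constant is confined to `[0, ∞)`, and `0` is attained only degenerately -/

/-- In any instance of the conclusion the constant is `≥ 0` (the ratio is non-negative and
`uω(u) > 0`); `A = 0` is attained exactly in the degenerate situations above (negative leading
coefficient, fixed prime divisor, squarefree reducible member), never — if the crux is true with the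
SieveCalibration value `A = C(f)/∏ deg fᵢ` — for a Bateman–Horn system. -/
theorem conclusion_const_nonneg {k : ℕ} {f : Fin k → ℤ[X]} {A u : ℝ} (hu : 2 < u)
    (h : Tendsto (ratio f u) atTop (𝓝 (A * (u * buchstabOmega u) ^ k))) : 0 ≤ A := by
  have hlim : 0 ≤ A * (u * buchstabOmega u) ^ k :=
    ge_of_tendsto' h fun x => ratio_nonneg f u x
  have hpos : 0 < (u * buchstabOmega u) ^ k := pow_pos (mul_buchstabOmega_pos (by linarith)) k
  exact nonneg_of_mul_nonneg_left hlim hpos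

/-! ### (c) A refuted natural strengthening: uniformity in `u` -/

/-- NATURAL STRENGTHENING: the limit of the crux taken UNIFORMLY in `u ∈ (2, ∞)`. -/
def RoughValueLawUniform : Prop :=
  ∀ (k : ℕ) (f : Fin k → ℤ[X]), IsBatemanHornSystem f → ∀ ω : ℝ → ℝ, IsBuchstab ω →
    ∃ A : ℝ, ∀ ε : ℝ, 0 < ε → ∀ᶠ x : ℕ in atTop, ∀ u : ℝ, 2 < u →
      |ratio f u x - A * (u * ω u) ^ k| ≤ ε

/-- When `x^{1/u} ≤ 2` nothing is sifted: the count of `(X)` is `x`. -/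
theorem roughCount_X_of_rpow_le_two {u : ℝ} {x : ℕ} (h : (x : ℝ) ^ (1 / u) ≤ 2) :
    roughCount ![(X : ℤ[X])] u x = x := by
  rw [roughCount_X]
  have e : roughIcc ⌈(x : ℝ) ^ (1 / u)⌉₊ x = Finset.Icc 1 x := by
    rw [roughIcc]
    refine Finset.filter_true_of_mem fun b _ p hp => ?_
    refine (Nat.ceil_mono h).trans ?_
    rw [Nat.ceil_ofNat]
    exact (Nat.prime_of_mem_primeFactors hp).two_le
  rw [e, Nat.card_Icc, Nat.add_sub_cancel]

/-- The uniform strengthening is FALSE already for `f = X`: the pointwise law forces `A = 1`, while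
at `u = 2 log x / log 2` (i.e. `x^{1/u} = √2`) nothing is sifted, the ratio is `log x`, and
`uω(u) ≥ u/2 = log x / log 2 > log x + 1/2`. (The limits `x → ∞` and `u → ∞` do not commute.) -/
theorem not_roughValueLawUniform : ¬ RoughValueLawUniform := by
  intro h
  obtain ⟨A, hA⟩ := h 1 ![X] isBatemanHornSystem_X buchstabOmega isBuchstab_buchstabOmega
  -- Step 1: `A = 1` from the pointwise limit at `u = 3`.
  have hA3 : Tendsto (ratio ![(X : ℤ[X])] 3) atTop (𝓝 (A * (3 * buchstabOmega 3) ^ 1)) := by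
    rw [Metric.tendsto_nhds]
    intro ε hε
    filter_upwards [hA (ε / 2) (by positivity)] with x hx
    rw [Real.dist_eq]
    exact (hx 3 (by norm_num)).trans_lt (by linarith)
  have hAeq : A = 1 := by
    have e := tendsto_nhds_unique (tendsto_ratio_X 3 (by norm_num)) hA3
    have hpos := mul_buchstabOmega_pos (u := 3) (by norm_num)
    rw [pow_one] at e
    exact ((mul_eq_right₀ hpos.ne').mp e.symm)
  subst hAeq
  -- Step 2: a large `x` and the depth `u = 2 log x / log 2`.
  obtain ⟨x, hx, hx8⟩ := ((hA (1 / 2) (by norm_num)).and (eventually_ge_atTop 8)).exists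
  have hx0 : (0 : ℝ) < x := by exact_mod_cast lt_of_lt_of_le (by norm_num) hx8
  have hlog2 : (0.6931471803 : ℝ) < Real.log 2 := Real.log_two_gt_d9
  have hlog2' : Real.log 2 < 0.6931471808 := Real.log_two_lt_d9
  have hl2pos : 0 < Real.log 2 := by linarith
  set L : ℝ := Real.log x with hL
  have hL8 : 3 * Real.log 2 ≤ L := by
    have e8 : (3 : ℝ) * Real.log 2 = Real.log 8 := by
      rw [show (8 : ℝ) = 2 ^ 3 by norm_num, Real.log_pow]; norm_num
    rw [hL, e8]
    exact Real.log_le_log (by norm_num) (by exact_mod_cast hx8)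
  have hL0 : L ≠ 0 := by linarith
  set u : ℝ := 2 * L / Real.log 2 with hu
  have hu2 : 2 < u := by
    rw [hu, lt_div_iff₀ hl2pos]
    linarith
  have hxu : (x : ℝ) ^ (1 / u) ≤ 2 := by
    rw [Real.rpow_def_of_pos hx0, ← hL]
    have : L * (1 / u) = Real.log 2 / 2 := by
      rw [hu]
      field_simp
    rw [this]
    calc Real.exp (Real.log 2 / 2) ≤ Real.exp (Real.log 2) := Real.exp_le_exp.mpr (by linarith)
      _ = 2 := Real.exp_log (by norm_num)
  have hratio : ratio ![(X : ℤ[X])] u x = L := by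
    simp only [ratio, roughCount_X_of_rpow_le_two hxu, pow_one]
    rw [mul_div_cancel_left₀ _ hx0.ne']
  have key := hx u hu2
  rw [hratio, pow_one, one_mul] at key
  have hω : 1 / 2 ≤ buchstabOmega u := half_le_buchstabOmega (by linarith)
  have h1 : u * buchstabOmega u ≤ L + 1 / 2 := by linarith [(abs_le.mp key).1]
  have h2 : u * (1 / 2) ≤ u * buchstabOmega u := by
    have : 0 ≤ u := by linarith
    exact mul_le_mul_of_nonneg_left hω this
  have h3 : u * (1 / 2) = L / Real.log 2 := by rw [hu]; ring
  have h4 : L / Real.log 2 ≤ L + 1 / 2 := by linarith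
  rw [div_le_iff₀ hl2pos] at h4
  nlinarith

/-! ### Strength calibration: below depth `u = 3` rough values are `P₂` -/

/-- Height bound: `|P(n)| ≤ (∑ |coeff|) · x^{deg P}` for `1 ≤ n ≤ x`. -/
theorem abs_eval_le (P : ℤ[X]) {x n : ℕ} (hn1 : 1 ≤ n) (hnx : n ≤ x) :
    |((P.eval (n : ℤ) : ℤ) : ℝ)| ≤
      (∑ j ∈ Finset.range (P.natDegree + 1), |(P.coeff j : ℝ)|) * (x : ℝ) ^ P.natDegree := by
  have hx1 : (1 : ℝ) ≤ x := by exact_mod_cast hn1.trans hnx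
  have hnx' : (n : ℝ) ≤ x := by exact_mod_cast hnx
  rw [eval_eq_sum_range, Int.cast_sum, Finset.sum_mul]
  refine (Finset.abs_sum_le_sum_abs _ _).trans (Finset.sum_le_sum fun j hj => ?_)
  rw [Finset.mem_range] at hj
  push_cast
  rw [abs_mul, abs_pow, abs_of_nonneg (by positivity : (0 : ℝ) ≤ n)]
  refine mul_le_mul_of_nonneg_left ?_ (abs_nonneg _)
  calc (n : ℝ) ^ j ≤ (x : ℝ) ^ j := by gcongr
    _ ≤ (x : ℝ) ^ P.natDegree := pow_le_pow_right₀ hx1 (by omega)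

/-- A positive integer all of whose prime factors are `≥ N` and which is `< N³` has `Ω ≤ 2`. -/
theorem cardFactors_le_two_of_rough {m N : ℕ} (hm : m ≠ 0)
    (hrough : ∀ p : ℕ, p.Prime → p ∣ m → N ≤ p) (hlt : m < N ^ 3) :
    ArithmeticFunction.cardFactors m ≤ 2 := by
  by_contra h
  push Not at h
  have h1 : N ^ ArithmeticFunction.cardFactors m ≤ m := by
    rw [ArithmeticFunction.cardFactors_apply]
    conv_rhs => rw [← Nat.prod_primeFactorsList hm]
    exact List.pow_card_le_prod _ _ fun p hp =>
      hrough p (Nat.prime_of_mem_primeFactorsList hp) (Nat.dvd_of_mem_primeFactorsList hp)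
  have hN : 1 ≤ N := by
    rcases Nat.eq_zero_or_pos N with h0 | h0
    · subst h0; simp at hlt
    · exact h0
  have h2 : N ^ 3 ≤ N ^ ArithmeticFunction.cardFactors m := Nat.pow_le_pow_right hN h
  omega

/-- **STRENGTH CALIBRATION.** For every family of non-constant polynomials and every depth
`u < 3`, once `x` is large EVERY jointly rough argument `n ≤ x` counted by the crux has
`Ω(fᵢ(n)) ≤ 2` in every coordinate (all prime factors are `≥ x^{dᵢ/u}` while
`fᵢ(n) ≪ x^{dᵢ} < x^{3dᵢ/u}`). Hence any rung `u ∈ (2,3)` of `RoughValueLaw` with `A > 0`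
(and `A = C(f)/∏ deg fᵢ > 0` is what `SieveCalibration` forces) yields `≫ x/(log x)^k` arguments
`n ≤ x` with every `fᵢ(n)` a `P₂` — for a single polynomial of degree `≥ 3` this is an OPEN
almost-prime problem (Richert's weighted sieve gives `P_{d+1}`; `P₂` is known only in degree `≤ 2`,
Iwaniec 1978 for `n²+1`). This is the precise sense in which every rung below `3` is of
Bateman–Horn strength. -/
theorem eventually_cardFactors_le_two {k : ℕ} (f : Fin k → ℤ[X])
    (hdeg : ∀ i, 0 < (f i).natDegree) {u : ℝ} (hu0 : 0 < u) (hu3 : u < 3) :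
    ∀ᶠ x : ℕ in atTop, ∀ n ∈ (Finset.Icc 1 x).filter (fun n : ℕ => ∀ i, 0 < (f i).eval (n : ℤ) ∧
      ∀ p ∈ Finset.range ⌈(x : ℝ) ^ (((f i).natDegree : ℝ) / u)⌉₊,
        p.Prime → ¬ ((p : ℤ) ∣ (f i).eval (n : ℤ))),
      ∀ i, ArithmeticFunction.cardFactors ((f i).eval (n : ℤ)).toNat ≤ 2 := by
  -- for each coordinate, eventually `B_i x^{d_i} < x^{3 d_i/u}`
  have hcoord : ∀ i, ∀ᶠ x : ℕ in atTop,
      (∑ j ∈ Finset.range ((f i).natDegree + 1), |((f i).coeff j : ℝ)|) * (x : ℝ) ^ (f i).natDegree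
        < ((x : ℝ) ^ (((f i).natDegree : ℝ) / u)) ^ 3 := by
    intro i
    set d : ℕ := (f i).natDegree with hd
    set B : ℝ := ∑ j ∈ Finset.range (d + 1), |((f i).coeff j : ℝ)| with hB
    have hdpos : (0 : ℝ) < d := by exact_mod_cast hdeg i
    have hexp : 0 < (d : ℝ) * (3 / u - 1) := by
      apply mul_pos hdpos
      rw [sub_pos, lt_div_iff₀ hu0]; linarith
    have ht : Tendsto (fun x : ℕ => (x : ℝ) ^ ((d : ℝ) * (3 / u - 1))) atTop atTop :=
      (tendsto_rpow_atTop hexp).comp tendsto_natCast_atTop_atTop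
    filter_upwards [ht.eventually_gt_atTop B, eventually_gt_atTop 0] with x hx hx0
    have hx0' : (0 : ℝ) < x := by exact_mod_cast hx0
    have e1 : ((x : ℝ) ^ ((d : ℝ) / u)) ^ 3 = (x : ℝ) ^ ((d : ℝ) * (3 / u - 1)) * (x : ℝ) ^ d := by
      rw [← Real.rpow_natCast ((x : ℝ) ^ ((d : ℝ) / u)) 3, ← Real.rpow_mul hx0'.le,
        ← Real.rpow_natCast (x : ℝ) d, ← Real.rpow_add hx0']
      congr 1
      push_cast
      ring
    rw [e1]
    exact mul_lt_mul_of_pos_right hx (by positivity)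
  have hall : ∀ᶠ x : ℕ in atTop, ∀ i,
      (∑ j ∈ Finset.range ((f i).natDegree + 1), |((f i).coeff j : ℝ)|) * (x : ℝ) ^ (f i).natDegree
        < ((x : ℝ) ^ (((f i).natDegree : ℝ) / u)) ^ 3 := eventually_all.mpr hcoord
  filter_upwards [hall] with x hx n hn i
  rw [Finset.mem_filter, Finset.mem_Icc] at hn
  obtain ⟨⟨hn1, hnx⟩, hgood⟩ := hn
  obtain ⟨hpos, hsift⟩ := hgood i
  set m : ℕ := ((f i).eval (n : ℤ)).toNat with hm
  have hmz : (m : ℤ) = (f i).eval (n : ℤ) := Int.toNat_of_nonneg hpos.le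
  have hm0 : m ≠ 0 := by
    intro h0; rw [h0] at hmz; simp at hmz; linarith
  set N : ℕ := ⌈(x : ℝ) ^ (((f i).natDegree : ℝ) / u)⌉₊ with hN
  refine cardFactors_le_two_of_rough (N := N) hm0 (fun p hp hpm => ?_) ?_
  · by_contra hlt
    push Not at hlt
    refine hsift p (Finset.mem_range.mpr hlt) hp ?_
    rw [← hmz]
    exact_mod_cast hpm
  · -- m ≤ B x^d < (x^{d/u})^3 ≤ N^3
    have h1 : (m : ℝ) ≤ (∑ j ∈ Finset.range ((f i).natDegree + 1), |((f i).coeff j : ℝ)|) *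
        (x : ℝ) ^ (f i).natDegree := by
      have := abs_eval_le (f i) hn1 hnx
      rw [← hmz] at this
      push_cast at this
      exact le_trans (le_abs_self _) this
    have h2 : ((x : ℝ) ^ (((f i).natDegree : ℝ) / u)) ^ 3 ≤ (N : ℝ) ^ 3 :=
      pow_le_pow_left₀ (by positivity) (Nat.le_ceil _) 3
    have h3 : (m : ℝ) < (N : ℝ) ^ 3 := lt_of_le_of_lt h1 ((hx i).trans_le h2)
    exact_mod_cast h3


end Summit.Parity.BatemanHorn.Cruxes.RoughValueLaw.Disproof
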